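import Literature.AnabelianGeometry.SemiGraphs.TemperedPiDecomposition
import Literature.AnabelianGeometry.SemiGraphs.TemperedPiLevels
import Literature.AnabelianGeometry.SemiGraphs.TemperedGaloisCountableOfStrictlyCoherent
import Literature.AnabelianGeometry.SemiGraphs.CharacteristicOpenCore
import HarnessLib

/-!
# Level kernels of the decomposition homomorphisms lie in the characteristic open cores
# ([SemiAnbd] Thm 3.7 (i)/(iii) pp. 40–41, Prop. 3.6 p. 38; [IUTchI] Rmk. 2.5.3 (i) (T2)/(T4))

Mochizuki, *Semi-graphs of anabelioids*, Publ. RIMS **42** (2006), §3: the tower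
`π₁^temp(𝒢) = lim_n Gal(𝒢_{∞,n}/𝒢)` of Prop. 3.6 p. 38 ("cofinal collection of connected finite étale
Galois coverings") and the decomposition homomorphisms `Π_v → π₁^temp(𝒢)` of Thm. 3.7 (i) p. 40
[cite: MochizukiSemiAnbd2006, Thm 3.7(i) p.40]; the splitting condition of [IUTchI] Rmk. 2.5.3 (i) (T2)
and the Galois-countability of strictly coherent graphs (T4) [cite: Mochizuki2012, IUTchI Rem. 2.5.3(i)(T4) p.53].

PROOF-ONLY file (no definitions).  Context: FRONTIER programme SUBDAG-REFUTE-F1732 of cell abc-iut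
(towards a kernel erratum for the ∀-countable reading of Thm. 3.7 (iii); print proves finite `𝔾`,
kernel `compactInVerticialAt_of_finiteGraph`), brick R6-level binder **(hK)** of abc-iut-L3-d4's
`SemiGraph.ray_not_critical_of_characters` (p437320): "`ker ψ ≤ ker ab`" for the level-`n` decomposition
homomorphism `ψ = proj n ∘ decompHom : Π_v → Gal(𝒢_{∞,n}/𝒢)`.  This file supplies the TOWER half,
for EVERY semi-graph of anabelioids (seat abc-iut-L3-t6, lineage DECOMP):

* `PointSeq.ρ_map_pt_eq_self_of_gal_eq_one`: if `h ∈ Π_v` lies in the kernel of the `n`-th component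
  `σ_n^h` of the decomposition homomorphism at a compatible point sequence `t` (abc-iut-L3-t6,
  `TemperedPiDecomposition.lean`: `gal_eq_one_iff`, the kernel is the stabiliser of `t n`), then `h`
  fixes the image of `t n` in EVERY covering dominated by `𝒢_{∞,n}` (equivariance `CovHom.fV_ρ`);
* `PointSeq.ρ_eq_self_of_gal_eq_one_of_splits`: hence `h` acts trivially on every finite étale covering
  SPLIT by the level `𝒢_n` (Def. 3.5 (ii) / (T2), `CovObj.Splits`, through `𝒢_{∞,n} → 𝒢_n`,
  `CovObj.univCoverOverProj`);
* `PointSeq.mem_charOpenCore_of_gal_eq_one`: so if `𝒢_n` splits a covering `F` whose point stabilisers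
  in `Π_v` lie in every open subgroup of index `≤ K` (brick R4 (A), abc-iut-w4-d075,
  `exists_finiteCov_stabilizers_le`), the level-`n` kernel lies in the characteristic open core
  `charOpenCore (Π_v) K` (`CharacteristicOpenCore.lean`);
* `exists_level_splits_of_isFinite`, `exists_level_gal_eq_one_mem_charOpenCore`: for the CANONICAL
  tower of Prop. 3.6 (abc-iut-L3-t9, `galoisLevelData h36`) and `𝒢` strictly coherent, every `K` has
  a level `n₀` beyond which ALL level kernels of ALL decomposition homomorphisms at ALL vertices lie in
  `charOpenCore (Π_v) K` — uniformly in the vertex and in the point sequence (Galois-countability: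
  the tower dominates the countable splitting family, `TemperedPiLevels.lean`).

Composed with «`charOpenCore (Π_v) K ≤ ker ab`» for an abelian quotient `ab` of index `≤ K` (for
`𝒢_θ`: `abMod e` of brick R1, index `p^{2e}`) this is (hK).  Nothing here is asserted about any
particular graph; nothing here bears on [IUTchIII] Cor. 3.12 (IUT uses finite dual semi-graphs).
-/

namespace Literature.AnabelianGeometry.SemiGraphs

namespace ProfiniteSemiGraph

open CategoryTheory Topology

universe u

variable {𝒢 : ProfiniteSemiGraph.{u}}

namespace GaloisLevelData

variable {D : GaloisLevelData 𝒢} {h𝒢 : 𝒢.IsCountable} {v : 𝒢.graph.Vertex}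

namespace PointSeq

/-- **Level kernel ⇒ stabiliser downstream.**  If `σ_n^h = 1` for the decomposition homomorphism at
the compatible point sequence `t` over `v` (i.e. `h` stabilises `t n`, `gal_eq_one_iff`), then `h`
fixes the image of `t n` under ANY morphism `𝒢_{∞,n} → F` of `B^cov(𝒢)`.
[cite: MochizukiSemiAnbd2006, Thm 3.7(i) p.40] -/
theorem ρ_map_pt_eq_self_of_gal_eq_one (T : D.PointSeq h𝒢 v) (n : ℕ) {F : CovObj 𝒢}
    (φ : D.cover h𝒢 n ⟶ F) (h : 𝒢.Gv v) (h1 : T.gal n h = 1) :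
    (F.SV v).obj.ρ h ((φ.fV v).hom.hom (T.pt n)) = (φ.fV v).hom.hom (T.pt n) := by
  rw [← CovHom.fV_ρ, (T.gal_eq_one_iff n h).mp h1]

/-- The same for the `n`-th projection of the decomposition homomorphism (`proj n ∘ decompHom`, which
IS `σ_n^•`). [cite: MochizukiSemiAnbd2006, Thm 3.7(i) p.40] -/
theorem ρ_map_pt_eq_self_of_proj_decompHom_eq_one (T : D.PointSeq h𝒢 v) (n : ℕ) {F : CovObj 𝒢}
    (φ : D.cover h𝒢 n ⟶ F) (h : 𝒢.Gv v) (h1 : D.proj h𝒢 n (T.decompHom h) = 1) :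
    (F.SV v).obj.ρ h ((φ.fV v).hom.hom (T.pt n)) = (φ.fV v).hom.hom (T.pt n) :=
  T.ρ_map_pt_eq_self_of_gal_eq_one n φ h (by rwa [T.proj_decompHom] at h1)

/-- **Level kernel ⇒ trivial action on every covering split by the level.**  If the level `𝒢_n`
splits `F` over every constituent anabelioid (Def. 3.5 (ii), `CovObj.Splits`) and `σ_n^h = 1`, then
`h ∈ Π_v` acts trivially on the fibre `F_v`: `h` stabilises `t n`, hence its image in `𝒢_n` under
`𝒢_{∞,n} → 𝒢_n`, whose stabiliser acts trivially on `F_v` by the splitting.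
[cite: MochizukiSemiAnbd2006, Def 3.5(ii) p.37] -/
theorem ρ_eq_self_of_gal_eq_one_of_splits (T : D.PointSeq h𝒢 v) (n : ℕ) {F : CovObj 𝒢}
    (hsplit : (D.S n).Splits F) (h : 𝒢.Gv v) (h1 : T.gal n h = 1) (s : (F.SV v).obj.V) :
    (F.SV v).obj.ρ h s = s :=
  hsplit.1 v _ h (T.ρ_map_pt_eq_self_of_gal_eq_one n
    ((D.S n).univCoverOverProj (Sum.inl (D.W n)) h𝒢) h h1) s

/-- **Level kernel ⇒ every open subgroup of bounded index.**  If `𝒢_n` splits a covering `F` with a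
point over `v` all of whose point stabilisers in `Π_v` lie in every open subgroup of index `≤ K` (the
covering `F_K` of brick R4 (A), `exists_finiteCov_stabilizers_le`), then `σ_n^h = 1` puts `h` in every
open subgroup of `Π_v` of index `≤ K`. [cite: Mochizuki2012, IUTchI Rem. 2.5.3(i)(T4) p.53] -/
theorem mem_of_gal_eq_one_of_splits (T : D.PointSeq h𝒢 v) (n : ℕ) {F : CovObj 𝒢}
    (hsplit : (D.S n).Splits F) (K : ℕ) (z : (F.SV v).obj.V)
    (hF : ∀ (z : (F.SV v).obj.V) (g : 𝒢.Gv v), (F.SV v).obj.ρ g z = z →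
      ∀ L : Subgroup (𝒢.Gv v), IsOpen (L : Set (𝒢.Gv v)) → L.index ≠ 0 → L.index ≤ K → g ∈ L)
    (h : 𝒢.Gv v) (h1 : T.gal n h = 1) (L : Subgroup (𝒢.Gv v)) (hLo : IsOpen (L : Set (𝒢.Gv v)))
    (hL0 : L.index ≠ 0) (hLK : L.index ≤ K) : h ∈ L :=
  hF z h (T.ρ_eq_self_of_gal_eq_one_of_splits n hsplit h h1 z) L hLo hL0 hLK

/-- **Level kernel ⇒ characteristic open core** (the tower half of (hK)): under the hypotheses of
`mem_of_gal_eq_one_of_splits`, `σ_n^h = 1 ⇒ h ∈ charOpenCore (Π_v) K`.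
[cite: Mochizuki2012, IUTchI Rem. 2.5.3(i)(T4) p.53] -/
theorem mem_charOpenCore_of_gal_eq_one (T : D.PointSeq h𝒢 v) (n : ℕ) {F : CovObj 𝒢}
    (hsplit : (D.S n).Splits F) (K : ℕ) (z : (F.SV v).obj.V)
    (hF : ∀ (z : (F.SV v).obj.V) (g : 𝒢.Gv v), (F.SV v).obj.ρ g z = z →
      ∀ L : Subgroup (𝒢.Gv v), IsOpen (L : Set (𝒢.Gv v)) → L.index ≠ 0 → L.index ≤ K → g ∈ L)
    (h : 𝒢.Gv v) (h1 : T.gal n h = 1) : h ∈ charOpenCore (𝒢.Gv v) K := by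
  rw [charOpenCore, Subgroup.mem_sInf]
  rintro L ⟨hLo, hL0, hLK⟩
  exact T.mem_of_gal_eq_one_of_splits n hsplit K z hF h h1 L hLo (Nat.pos_iff_ne_zero.mp hL0) hLK

/-- `proj n ∘ decompHom` spelling of `mem_charOpenCore_of_gal_eq_one`.
[cite: Mochizuki2012, IUTchI Rem. 2.5.3(i)(T4) p.53] -/
theorem mem_charOpenCore_of_proj_decompHom_eq_one (T : D.PointSeq h𝒢 v) (n : ℕ) {F : CovObj 𝒢}
    (hsplit : (D.S n).Splits F) (K : ℕ) (z : (F.SV v).obj.V)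
    (hF : ∀ (z : (F.SV v).obj.V) (g : 𝒢.Gv v), (F.SV v).obj.ρ g z = z →
      ∀ L : Subgroup (𝒢.Gv v), IsOpen (L : Set (𝒢.Gv v)) → L.index ≠ 0 → L.index ≤ K → g ∈ L)
    (h : 𝒢.Gv v) (h1 : D.proj h𝒢 n (T.decompHom h) = 1) : h ∈ charOpenCore (𝒢.Gv v) K :=
  T.mem_charOpenCore_of_gal_eq_one n hsplit K z hF h (by rwa [T.proj_decompHom] at h1)

end PointSeq

end GaloisLevelData

/-! ### The canonical tower of Proposition 3.6: uniform levels -/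

variable (𝒢) in
/-- **Cofinality of the canonical tower on finite coverings** ([SemiAnbd] p. 38 "cofinal"; [IUTchI]
Rmk. 2.5.3 (i) (T2)): every FINITE object of `B^cov(𝒢)` is split by the levels `𝒢_n` of the canonical
Galois tower from some level on — Galois-countability gives a member of the countable family splitting
it and the tower dominates that member (`TemperedPiLevels.lean`).
[cite: Mochizuki2012, IUTchI Rmk 2.5.3 (i) (T2), p. 52] -/
theorem exists_level_splits_of_isFinite (h36 : 𝒢.Prop36Hypotheses) (F : CovObj 𝒢) (hF : F.IsFinite) :
    ∃ n₀ : ℕ, ∀ n, n₀ ≤ n → ((𝒢.galoisLevelData h36).S n).Splits F := by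
  obtain ⟨i, hi⟩ := h36.isGaloisCountable.2.choose_spec.2 F hF
  refine ⟨i, fun n hin => ?_⟩
  obtain ⟨f⟩ := 𝒢.exists_hom_level_le h36 hin
  obtain ⟨g⟩ := 𝒢.exists_hom_level_gcFamily h36 i
  exact CovObj.Splits.of_hom (f ≫ g) hi

variable (𝒢) in
/-- **(hK), tower half, for the canonical tower and a strictly coherent `𝒢`.**  For every `K` there
is a level `n₀` such that for ALL `n ≥ n₀`, ALL vertices `v`, ALL compatible point sequences `t` over
`v` and all `h ∈ Π_v`: `σ_n^h = 1 ⇒ h ∈ charOpenCore (Π_v) K` — the level-`n` kernel of every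
decomposition homomorphism lies in the characteristic open core of level `K`.  Ingredients: brick R4 (A)
(`exists_finiteCov_stabilizers_le`, abc-iut-w4-d075) and the cofinality of the tower.
[cite: Mochizuki2012, IUTchI Rem. 2.5.3(i)(T4) p.53] -/
theorem exists_level_gal_eq_one_mem_charOpenCore (h36 : 𝒢.Prop36Hypotheses)
    (hsc : 𝒢.IsStrictlyCoherent) (K : ℕ) :
    ∃ n₀ : ℕ, ∀ n, n₀ ≤ n → ∀ (v : 𝒢.graph.Vertex)
      (T : (𝒢.galoisLevelData h36).PointSeq h36.isCountable v) (h : 𝒢.Gv v),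
      T.gal n h = 1 → h ∈ charOpenCore (𝒢.Gv v) K := by
  obtain ⟨F, hFfin, hFne, hFV, -⟩ := exists_finiteCov_stabilizers_le h36.isQuasiCoherent hsc K
  obtain ⟨n₀, hn₀⟩ := 𝒢.exists_level_splits_of_isFinite h36 F hFfin
  refine ⟨n₀, fun n hn v T h h1 => ?_⟩
  obtain ⟨z⟩ := hFne.nonempty_V v
  exact T.mem_charOpenCore_of_gal_eq_one n (hn₀ n hn) K z (hFV v) h h1

variable (𝒢) in
/-- `proj n ∘ decompHom` spelling of `exists_level_gal_eq_one_mem_charOpenCore`: beyond the level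
`n₀ = n₀(K)`, `proj n (decompHom_t h) = 1 ⇒ h ∈ charOpenCore (Π_v) K` for every vertex, point
sequence and `h`. [cite: Mochizuki2012, IUTchI Rem. 2.5.3(i)(T4) p.53] -/
theorem exists_level_proj_decompHom_eq_one_mem_charOpenCore (h36 : 𝒢.Prop36Hypotheses)
    (hsc : 𝒢.IsStrictlyCoherent) (K : ℕ) :
    ∃ n₀ : ℕ, ∀ n, n₀ ≤ n → ∀ (v : 𝒢.graph.Vertex)
      (T : (𝒢.galoisLevelData h36).PointSeq h36.isCountable v) (h : 𝒢.Gv v),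
      (𝒢.galoisLevelData h36).proj h36.isCountable n (T.decompHom h) = 1 →
        h ∈ charOpenCore (𝒢.Gv v) K := by
  obtain ⟨n₀, hn₀⟩ := 𝒢.exists_level_gal_eq_one_mem_charOpenCore h36 hsc K
  exact ⟨n₀, fun n hn v T h h1 => hn₀ n hn v T h (by rwa [T.proj_decompHom] at h1)⟩

variable (𝒢) in
/-- **(hK) in the binder shape of `SemiGraph.ray_not_critical_of_characters`**, modulo the group-side
input «`charOpenCore (Π_v) K ≤ ker ab`»: beyond `n₀(K)`, for `ψ := proj n ∘ decompHom_t` and any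
homomorphism `ab` out of `Π_v` killing `charOpenCore (Π_v) K`, `ψ x = 1 → ab x = 1`.
[cite: Mochizuki2012, IUTchI Rem. 2.5.3(i)(T4) p.53] -/
theorem exists_level_hK (h36 : 𝒢.Prop36Hypotheses) (hsc : 𝒢.IsStrictlyCoherent) (K : ℕ) :
    ∃ n₀ : ℕ, ∀ n, n₀ ≤ n → ∀ (v : 𝒢.graph.Vertex)
      (T : (𝒢.galoisLevelData h36).PointSeq h36.isCountable v) {V : Type*} [Group V]
      (ab : 𝒢.Gv v →* V), charOpenCore (𝒢.Gv v) K ≤ ab.ker →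
      ∀ x : 𝒢.Gv v, ((𝒢.galoisLevelData h36).proj h36.isCountable n).comp T.decompHom x = 1 →
        ab x = 1 := by
  obtain ⟨n₀, hn₀⟩ := 𝒢.exists_level_proj_decompHom_eq_one_mem_charOpenCore h36 hsc K
  exact ⟨n₀, fun n hn v T V _ ab hab x hx => hab (hn₀ n hn v T x hx)⟩

/-! ### v2 (append-only): the consumer form without `charOpenCore` in the statement -/

variable (𝒢) in
/-- **(hK) for every open finite-index kernel of bounded index** (v2, append-only; the form a consumer
binds without mentioning `charOpenCore`): for the canonical tower of a strictly coherent `𝒢` and every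
bound `d`, beyond a level `n₀(d)`, for EVERY vertex `v`, point sequence `t` over `v` and homomorphism
`ab : Π_v →* V` whose kernel is open of (finite, positive) index `≤ d`:
`proj n (decompHom_t x) = 1 → ab x = 1`.  (`charOpenCore (Π_v) d ≤ ker ab` by `charOpenCore_le`.)
At `𝒢_θ`: `ab := abMod e` (brick R1 part 3), `d := p ^ (2 * e)`.
[cite: Mochizuki2012, IUTchI Rem. 2.5.3(i)(T4) p.53] -/
theorem exists_level_hK_of_index_le (h36 : 𝒢.Prop36Hypotheses) (hsc : 𝒢.IsStrictlyCoherent) (d : ℕ) :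
    ∃ n₀ : ℕ, ∀ n, n₀ ≤ n → ∀ (v : 𝒢.graph.Vertex)
      (T : (𝒢.galoisLevelData h36).PointSeq h36.isCountable v) {V : Type*} [Group V]
      (ab : 𝒢.Gv v →* V), IsOpen (ab.ker : Set (𝒢.Gv v)) → ab.ker.index ≠ 0 → ab.ker.index ≤ d →
      ∀ x : 𝒢.Gv v, ((𝒢.galoisLevelData h36).proj h36.isCountable n).comp T.decompHom x = 1 →
        ab x = 1 := by
  obtain ⟨n₀, hn₀⟩ := 𝒢.exists_level_hK h36 hsc d
  exact ⟨n₀, fun n hn v T V _ ab hopen h0 hle x hx =>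
    hn₀ n hn v T ab (charOpenCore_le ⟨hopen, Nat.pos_iff_ne_zero.mpr h0, hle⟩) x hx⟩

variable (𝒢) in
/-- The same in the `σ_n^x = 1` (`PointSeq.gal`) spelling.
[cite: Mochizuki2012, IUTchI Rem. 2.5.3(i)(T4) p.53] -/
theorem exists_level_gal_eq_one_ker_of_index_le (h36 : 𝒢.Prop36Hypotheses)
    (hsc : 𝒢.IsStrictlyCoherent) (d : ℕ) :
    ∃ n₀ : ℕ, ∀ n, n₀ ≤ n → ∀ (v : 𝒢.graph.Vertex)
      (T : (𝒢.galoisLevelData h36).PointSeq h36.isCountable v) {V : Type*} [Group V]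
      (ab : 𝒢.Gv v →* V), IsOpen (ab.ker : Set (𝒢.Gv v)) → ab.ker.index ≠ 0 → ab.ker.index ≤ d →
      ∀ x : 𝒢.Gv v, T.gal n x = 1 → ab x = 1 := by
  obtain ⟨n₀, hn₀⟩ := 𝒢.exists_level_hK_of_index_le h36 hsc d
  exact ⟨n₀, fun n hn v T V _ ab hopen h0 hle x hx =>
    hn₀ n hn v T ab hopen h0 hle x (by rw [MonoidHom.comp_apply, T.proj_decompHom]; exact hx)⟩

end ProfiniteSemiGraph

end Literature.AnabelianGeometry.SemiGraphs
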